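import Literature.Analysis.FluidPDE.ChaeWolfRemovingDSSLimit
import Literature.Analysis.FluidPDE.NSBoundedMildOseenClassical
import Literature.Analysis.FluidPDE.PressureReconstruction
import Literature.Analysis.FluidPDE.LeraySelfSimilarCalculus
import Literature.Analysis.FluidPDE.TsaiSelfSimilarHolds
import Literature.Analysis.FluidPDE.KNSSMildRegularity
import HarnessLib

/-!
# Chae–Wolf 2017, Theorem 1.3 (removing `λ`-DSS singularities for `λ` near `1`): the discharge

Analysis/FluidPDE proofs file (everything proved; no definitions, no named facts), last of three
files discharging the named fact `Literature.Analysis.FluidPDE.chaeWolf2017_removing_dss`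
(`ChaeWolfRemovingDSS.lean`; D. Chae, J. Wolf, *Removing discretely self-similar singularities for
the 3D Navier–Stokes equations*, Comm. PDE 42 (2017) 1359–1374 = arXiv:1610.09464, **Theorem 1.3**
p. 3, proof §3 pp. 8–9):

* `ChaeWolf.limit_eq_zero` — the end of the printed proof: a continuous, Type I, self-similar
  (`μ ≥ 1`) bounded weak solution `v` on `(−∞, −1/4)` vanishes at time `−1`. Some slice `v(t₁)` is
  smooth by KNSS 2009 §4 (`KNSS2009_regularity_boundedWeak_window_holds`), hence so is
  `U = v(−1)` and `v = lerayBackward (1/2) 0 U` is jointly smooth (`LeraySelfSimilarCalculus`); a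
  smooth bounded weak solution has a pressure (`integral_inner_momentum_eq_zero_of_slab_weak`,
  `exists_isClassicalNSSolutionOn_of_forall_integral_inner_eq_zero`), so `(U, p(−1))` is a Leray
  profile with `ν = 1`, `a = 1/2` (`timeDeriv_lerayBackward`); the Type I bound puts `U ∈ L⁴(ℝ³)`
  and **Tsai 1998, Thm. 1** (`tsai_selfsimilar_holds`, proved in the tree) gives `U = 0` — the
  printed "we are in a position to apply Tsai's result [Tsai1998], to see that `u` is identical
  zero" (print invokes the local-energy form, Tsai's Thm. 2; the `L^q` form, Tsai's Thm. 1,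
  applies because the limit inherits the Type I bound);
* `chaeWolf2017_removing_dss_holds` — **the discharge**: if the statement failed for `C₀`, the
  nontrivial `c_n`-DSS solutions with `c_n ↓ 1` would have a nontrivial self-similar limit
  (`ChaeWolf.exists_limit`, `ChaeWolfRemovingDSSLimit.lean`), contradicting `ChaeWolf.limit_eq_zero`.

The trust base of `chaeWolf2017_removing_dss` is thereby Mathlib's axioms only.

## References

* D. Chae, J. Wolf, Comm. PDE 42 (2017) 1359–1374 = arXiv:1610.09464, Thm. 1.3 (p. 3), §3
  (pp. 8–9). [ChaeWolf2017RemovingDSS]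
* T.-P. Tsai, Arch. Rational Mech. Anal. 143 (1998), Thm. 1. [Tsai1998]
* G. Koch, N. Nadirashvili, G. Seregin, V. Šverák, Acta Math. 203 (2009) = arXiv:0709.3599, §4.
  [KochNadirashviliSereginSverak2009]
-/

noncomputable section

open MeasureTheory Set Function Filter Metric Real
open _root_.Topology
open scoped ENNReal NNReal ContDiff Laplacian

namespace Literature.Analysis.FluidPDE

namespace ChaeWolf


/-! ### Self-similar fields: relation between slices -/

/-- For a field which is `μ`-self-similar for every `μ ≥ 1` on `t ≤ −1/4`, any two slices are
rescalings of each other: `v(t, x) = ρ v(s, ρx)`, `ρ = √(s/t)`. [folklore] -/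
theorem slice_eq_smul_slice {v : ℝ → EuclideanSpace ℝ (Fin 3) → EuclideanSpace ℝ (Fin 3)}
    (hss : ∀ μ : ℝ, 1 ≤ μ → ∀ t ≤ -(1 / 4 : ℝ), ∀ x, v t x = μ • v (μ ^ 2 * t) (μ • x))
    {s t : ℝ} (hs : s ≤ -(1 / 4 : ℝ)) (ht : t ≤ -(1 / 4 : ℝ)) (x : EuclideanSpace ℝ (Fin 3)) :
    v t x = √(s / t) • v s (√(s / t) • x) := by
  have ht0 : t < 0 := by linarith
  have hs0 : s < 0 := by linarith
  have hst0 : 0 < s / t := div_pos_of_neg_of_neg hs0 ht0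
  rcases le_total s t with hle | hle
  · -- `s ≤ t`: `μ = √(s/t) ≥ 1`
    have h1 : 1 ≤ s / t := by rw [le_div_iff_of_neg ht0]; linarith
    have hμ : 1 ≤ √(s / t) := Real.one_le_sqrt.2 h1
    have key := hss _ hμ t ht x
    rwa [Real.sq_sqrt hst0.le, div_mul_cancel₀ _ ht0.ne] at key
  · -- `t ≤ s`: `μ' = √(t/s) ≥ 1`, applied at time `s` and the point `μ'⁻¹ x`
    have hts0 : 0 < t / s := div_pos_of_neg_of_neg ht0 hs0
    have h1 : 1 ≤ t / s := by rw [le_div_iff_of_neg hs0]; linarith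
    have hμ : 1 ≤ √(t / s) := Real.one_le_sqrt.2 h1
    have hμ0 : 0 < √(t / s) := by positivity
    have key := hss _ hμ s hs ((√(t / s))⁻¹ • x)
    rw [Real.sq_sqrt hts0.le, div_mul_cancel₀ _ hs0.ne, smul_smul, mul_inv_cancel₀ hμ0.ne',
      one_smul] at key
    have hinv : (√(t / s))⁻¹ = √(s / t) := by rw [← Real.sqrt_inv, inv_div]
    rw [← hinv, key, smul_smul, inv_mul_cancel₀ hμ0.ne', one_smul]

/-- The slices of such a field are Leray's backward ansatz of the slice at time `−1`:
`v(t) = lerayBackward (1/2) 0 (v(−1)) t` for `t ≤ −1/4`. [folklore] -/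
theorem slice_eq_lerayBackward {v : ℝ → EuclideanSpace ℝ (Fin 3) → EuclideanSpace ℝ (Fin 3)}
    (hss : ∀ μ : ℝ, 1 ≤ μ → ∀ t ≤ -(1 / 4 : ℝ), ∀ x, v t x = μ • v (μ ^ 2 * t) (μ • x))
    {t : ℝ} (ht : t ≤ -(1 / 4 : ℝ)) (x : (EuclideanSpace ℝ (Fin 3))) :
    v t x = lerayBackward (1 / 2) 0 (v (-1)) t x := by
  rw [lerayBackward_apply, slice_eq_smul_slice hss (s := -1) (by norm_num) ht x]
  have e1 : (2 : ℝ) * (1 / 2) * (0 - t) = -t := by ring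
  have e2 : √(-1 / t) = (√(-t))⁻¹ := by
    rw [← Real.sqrt_inv, show (-t)⁻¹ = -1 / t by rw [inv_neg, inv_eq_one_div, ← neg_div]]
  rw [e1, e2]

/-! ### The contradiction: a nontrivial self-similar Type I limit cannot exist -/

/-- **Chae–Wolf 2017, proof of Thm. 1.3, conclusion: the self-similar limit vanishes by Tsai's
theorem.** A continuous field `v` on `(−∞, −1/4] × ℝ³` which obeys a Type I bound, is a bounded
weak Navier–Stokes solution on `(−∞, −1/4)` and is `μ`-self-similar for every `μ ≥ 1` vanishes
at time `−1`. Mechanism: by KNSS 2009 §4 (`KNSS2009_regularity_boundedWeak_window_holds`) some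
slice `v(t₁)` is smooth, hence so is `U = v(−1)` (a rescaling of it) and
`v = lerayBackward (1/2) 0 U` is jointly smooth; a smooth bounded weak solution has a pressure
(`integral_inner_momentum_eq_zero_of_slab_weak`,
`exists_isClassicalNSSolutionOn_of_forall_integral_inner_eq_zero`), so `(U, p(−1))` is a Leray
profile with `a = 1/2` (`timeDeriv_lerayBackward`); the Type I bound puts `U ∈ L⁴(ℝ³)`, and Tsai
1998, Thm. 1 (`tsai_selfsimilar_holds`) gives `U = 0`. (Printed: "Hence `u` is a backward
self-similar solution … fulfilling `|u| ≤ C/(√(−t) + |x|)` … we are in a position to apply Tsai's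
result [Tsai1998], to see that `u` is identical zero.") [cite: ChaeWolf2017RemovingDSS, §3, end of the proof of Thm. 1.3 (arXiv:1610.09464 p. 9)] -/
theorem limit_eq_zero {C₀ : ℝ} {v : ℝ → EuclideanSpace ℝ (Fin 3) → EuclideanSpace ℝ (Fin 3)}
    (hvc : Continuous (uncurry v))
    (hvI : ∀ t ≤ -(1 / 4 : ℝ), ∀ x, ‖v t x‖ ≤ C₀ / (‖x‖ + √(-t)))
    (hweak : IsBoundedWeakNSSolutionOn (Iio 0) isOpen_Iio 1 (fun t => v (t - 1 / 4)))
    (hss : ∀ μ : ℝ, 1 ≤ μ → ∀ t ≤ -(1 / 4 : ℝ), ∀ x, v t x = μ • v (μ ^ 2 * t) (μ • x)) :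
    v (-1) = 0 := by
  have hC₀ : 0 ≤ C₀ := by
    have h := hvI (-1) (by norm_num) 0
    rw [norm_zero, zero_add, neg_neg, Real.sqrt_one, div_one] at h
    exact (norm_nonneg _).trans h
  have hvb : ∀ t ≤ -(1 / 4 : ℝ), ∀ x, ‖v t x‖ ≤ 2 * C₀ := by
    intro t ht x
    refine (hvI t ht x).trans ?_
    have h12 : (1 / 2 : ℝ) ≤ √(-t) := (Real.le_sqrt' (by norm_num)).2 (by nlinarith)
    have hden : (1 / 2 : ℝ) ≤ ‖x‖ + √(-t) := by linarith [norm_nonneg x]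
    calc C₀ / (‖x‖ + √(-t)) ≤ C₀ / (1 / 2) :=
          div_le_div_of_nonneg_left hC₀ (by norm_num) hden
      _ = 2 * C₀ := by ring
  have hvslice : ∀ t, Continuous (v t) := fun t =>
    hvc.comp (continuous_const.prodMk continuous_id)
  -- Step 1: a smooth slice `v t₁`, `t₁ < -1/4` (KNSS regularity on the window `(0, 2)` of
  -- `τ ↦ v(τ − 9/4)`)
  obtain ⟨t₁, ht₁, hsm₁⟩ : ∃ t₁ < -(1 / 4 : ℝ), ContDiff ℝ ∞ (v t₁) := by
    obtain ⟨Cw, Lw, N, hwin⟩ :=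
      KNSS2009_regularity_boundedWeak_window_holds (2 * C₀) 2 (by norm_num)
    have hw2 : IsBoundedWeakNSSolutionOn (Ioo 0 2) isOpen_Ioo 1
        (fun τ => v (τ + -2 - 1 / 4)) :=
      (hweak.mono (J := Ioo (-2) 0) isOpen_Ioo Ioo_subset_Iio_self).comp_add_right (-2)
        (J := Ioo 0 2) isOpen_Ioo fun τ => by
          simp only [mem_Ioo]
          constructor <;> intro h <;> constructor <;> linarith [h.1, h.2]
    have hM : ∀ τ ∈ Ioo (0 : ℝ) 2, ∀ x, ‖v (τ + -2 - 1 / 4) x‖ ≤ 2 * C₀ := fun τ hτ x =>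
      hvb _ (by linarith [hτ.2]) x
    obtain ⟨U, b, -, -, -, hae, hUs, -⟩ := hwin hw2 hM
    have hne : (ae ((volume : Measure ℝ).restrict (Ioo (0 : ℝ) 2))).NeBot := by
      rw [ae_neBot, Ne, Measure.restrict_eq_zero, Real.volume_Ioo]
      norm_num
    obtain ⟨τ₁, hτ₁, hτ₁m⟩ := (hae.and (ae_restrict_mem measurableSet_Ioo)).exists
    refine ⟨τ₁ + -2 - 1 / 4, by linarith [hτ₁m.2], ?_⟩
    have hc2 : Continuous fun x => U τ₁ x + b τ₁ :=
      (hUs τ₁ hτ₁m).continuous.add continuous_const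
    have heq : v (τ₁ + -2 - 1 / 4) = fun x => U τ₁ x + b τ₁ :=
      (Continuous.ae_eq_iff_eq volume (hvslice _) hc2).1 hτ₁
    rw [heq]
    exact (hUs τ₁ hτ₁m).add contDiff_const
  -- Step 2: the profile `U₀ = v(-1)` is smooth
  set U₀ : (EuclideanSpace ℝ (Fin 3)) → (EuclideanSpace ℝ (Fin 3)) := v (-1) with hU₀
  have hU₀s : ContDiff ℝ ∞ U₀ := by
    have hρ : ∀ x, U₀ x = √(t₁ / (-1)) • v t₁ (√(t₁ / (-1)) • x) := fun x =>
      slice_eq_smul_slice hss ht₁.le (by norm_num) x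
    rw [show U₀ = fun x => √(t₁ / (-1)) • v t₁ (√(t₁ / (-1)) • x) from funext hρ]
    exact (hsm₁.comp (contDiff_id.const_smul _)).const_smul _
  -- Step 3: the window `(0, 15/4)` of `W τ = v(τ − 4) = lerayBackward (1/2) 4 U₀ τ`
  set W : ℝ → EuclideanSpace ℝ (Fin 3) → EuclideanSpace ℝ (Fin 3) :=
    fun τ => v (τ + -(15 / 4) - 1 / 4) with hW
  have hWeq : ∀ τ ≤ (15 / 4 : ℝ), ∀ x, W τ x = lerayBackward (1 / 2) 4 U₀ τ x := by
    intro τ hτ x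
    have h := slice_eq_lerayBackward hss (t := τ + -(15 / 4) - 1 / 4) (by linarith) x
    simp only [hW, h, lerayBackward_apply]
    congr 2 <;> ring_nf
  have hWsm : IsSmoothSpaceTimeOn (Ioo 0 (15 / 4)) W := by
    have h1 := contDiffOn_uncurry_lerayBackward (a := 1 / 2) (by norm_num) hU₀s 4
    refine (h1.mono (prod_mono (fun τ hτ => ?_) Subset.rfl)).congr fun q hq => ?_
    · simp only [mem_Iio]; linarith [hτ.2]
    · simp only [uncurry]
      exact hWeq q.1 (le_of_lt (mem_prod.1 hq).1.2) q.2
  have hWweak : IsBoundedWeakNSSolutionOn (Ioo 0 (15 / 4)) isOpen_Ioo 1 W :=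
    (hweak.mono (J := Ioo (-(15 / 4)) 0) isOpen_Ioo Ioo_subset_Iio_self).comp_add_right
      (-(15 / 4)) (J := Ioo 0 (15 / 4)) isOpen_Ioo fun τ => by
        simp only [mem_Ioo]
        constructor <;> intro h <;> constructor <;> linarith [h.1, h.2]
  have hWdiv : ∀ τ ∈ Ioo (0 : ℝ) (15 / 4), VectorCalculus.IsDivFree (W τ) := fun τ hτ =>
    isDivFree_of_ae_isWeaklyDivFree_of_smooth hWsm hWweak.ae_isWeaklyDivFree hτ
  -- Step 4: the pressure
  have horth := fun {τ : ℝ} (hτ : τ ∈ Ioo (0 : ℝ) (15 / 4))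
      {φ : EuclideanSpace ℝ (Fin 3) → EuclideanSpace ℝ (Fin 3)}
      (hφ : FunctionSpaces.IsTestFunctionOn
        (⊤ : TopologicalSpace.Opens (EuclideanSpace ℝ (Fin 3))) φ)
      (hφd : VectorCalculus.IsDivFree φ) =>
    integral_inner_momentum_eq_zero_of_slab_weak hWsm hWdiv hWweak.2.2.2 hτ hφ hφd
  have hf0 : IsSmoothSpaceTimeOn (Ioo 0 (15 / 4))
      (0 : ℝ → EuclideanSpace ℝ (Fin 3) → EuclideanSpace ℝ (Fin 3)) := contDiffOn_const
  obtain ⟨P, hcl⟩ := exists_isClassicalNSSolutionOn_of_forall_integral_inner_eq_zero isOpen_Ioo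
    hWsm hf0 hWdiv (fun τ hτ φ hφ hφd => horth hτ hφ hφd)
  -- Step 5: the Leray profile at `τ₀ = 3`
  have h3 : (3 : ℝ) ∈ Ioo (0 : ℝ) (15 / 4) := ⟨by norm_num, by norm_num⟩
  have hW3 : W 3 = U₀ := by
    funext x; simp only [hW, hU₀]; norm_num
  have hU₀n : ∀ n : ℕ, ContDiff ℝ n U₀ := fun n => hU₀s.of_le (mod_cast le_top)
  have hU₀1 : ContDiff ℝ 1 U₀ := hU₀n 1
  have htd : ∀ x, timeDerivWithin (Ioo 0 (15 / 4)) W 3 x =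
      (1 / 2 : ℝ) • (U₀ x + fderiv ℝ U₀ x x) := by
    intro x
    rw [timeDerivWithin_of_mem_interior (by rw [interior_Ioo]; exact h3), timeDeriv]
    have hev : (fun s => W s x) =ᶠ[𝓝 3] fun s => lerayBackward (1 / 2) 4 U₀ s x := by
      filter_upwards [Iio_mem_nhds (show (3 : ℝ) < 15 / 4 by norm_num)] with s hs
      exact hWeq s hs.le x
    rw [hev.deriv_eq]
    have key := timeDeriv_lerayBackward (a := 1 / 2) (T := 4) (t := 3) (by norm_num) (by norm_num)
      hU₀1 x
    rw [timeDeriv] at key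
    rw [key]
    have e : (2 : ℝ) * (1 / 2) * (4 - 3) = 1 := by norm_num
    rw [e, Real.sqrt_one]
    simp
  have hprof : IsLerayProfile 1 (1 / 2) U₀ (P 3) := by
    refine ⟨hU₀n 2, (hcl.contDiff_pressure h3).of_le (mod_cast le_top), fun y => ?_,
      by rw [← hW3]; exact hWdiv 3 h3⟩
    have hm := hcl.momentum 3 h3 y
    rw [htd, hW3] at hm
    simp only [Pi.zero_apply, add_zero, smul_add] at hm
    have e : -((1 : ℝ) • Δ U₀ y) + (1 / 2 : ℝ) • U₀ y + (1 / 2 : ℝ) • (fderiv ℝ U₀ y) y +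
        convect U₀ U₀ y + gradient (P 3) y =
        ((1 / 2 : ℝ) • U₀ y + (1 / 2 : ℝ) • (fderiv ℝ U₀ y) y + convect U₀ U₀ y) -
          ((1 : ℝ) • Δ U₀ y - gradient (P 3) y) := by abel
    rw [e, hm, sub_self]
  -- Step 6: `U₀ ∈ L⁴`
  have hU₀b : ∀ y, ‖U₀ y‖ ≤ C₀ / (1 + ‖y‖) := fun y => by
    have h := hvI (-1) (by norm_num) y
    rwa [neg_neg, Real.sqrt_one, add_comm] at h
  have hmem : MemLp U₀ 4 (volume : Measure (EuclideanSpace ℝ (Fin 3))) := by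
    have hmeas : AEStronglyMeasurable U₀ volume := hU₀s.continuous.aestronglyMeasurable
    refine (integrable_norm_rpow_iff hmeas (by norm_num) (by simp)).1 ?_
    have hr : ((Module.finrank ℝ (EuclideanSpace ℝ (Fin 3)) : ℕ) : ℝ) < 4 := by simp; norm_num
    have hg : Integrable (fun y : EuclideanSpace ℝ (Fin 3) => C₀ ^ 4 * (1 + ‖y‖) ^ (-(4 : ℝ))) :=
      (integrable_one_add_norm hr).const_mul _
    refine hg.mono' (hU₀s.continuous.norm.rpow_const fun _ => Or.inr ENNReal.toReal_nonneg
      ).aestronglyMeasurable (Eventually.of_forall fun y => ?_)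
    have hpos : 0 < 1 + ‖y‖ := by positivity
    rw [ENNReal.toReal_ofNat, Real.norm_of_nonneg (by positivity),
      show (4 : ℝ) = ((4 : ℕ) : ℝ) by norm_num, Real.rpow_natCast, Real.rpow_neg hpos.le,
      Real.rpow_natCast, ← div_eq_mul_inv, ← div_pow]
    exact pow_le_pow_left₀ (norm_nonneg _) (hU₀b y) 4
  -- Step 7: Tsai's theorem
  exact tsai_selfsimilar_holds one_pos (by norm_num) hprof (q := 4) (by norm_num) (by simp) hmem


end ChaeWolf

/-- **Discharge of `chaeWolf2017_removing_dss` (Chae–Wolf 2017, Theorem 1.3).** For every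
`C₀ > 0` there is `c₁ > 1` such that every classical `c`-DSS solution, `1 < c < c₁`, of
Navier–Stokes on `ℝ³ × (−∞, 0)` with the Type I bound `‖u‖ ≤ C₀/(‖x‖ + √(−t))` vanishes. Proof by
contradiction as printed (§3): a sequence of nontrivial `c_n`-DSS solutions with `c_n ↓ 1` has a
locally uniform limit (`ChaeWolf.exists_limit`: KNSS a priori bounds and Arzelà–Ascoli) which is
self-similar, Type I, a bounded weak solution, and nontrivial at time `−1`
(`ChaeWolf.exists_witness`, replacing the printed `ε`-regularity step by the smallness lemma
`ChaeWolf.exists_eps_typeI_small_eq_zero`); but such a limit is a Leray profile in `L⁴` and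
vanishes by Tsai 1998, Thm. 1 (`ChaeWolf.limit_eq_zero`, `tsai_selfsimilar_holds`). [cite: ChaeWolf2017RemovingDSS, Theorem 1.3 and §3 (arXiv:1610.09464 pp. 3, 8–9)] -/
theorem chaeWolf2017_removing_dss_holds : chaeWolf2017_removing_dss := by
  intro C₀ hC₀
  by_contra H
  push Not at H
  have hpos : ∀ n : ℕ, (1 : ℝ) < 1 + 1 / ((n : ℝ) + 1) := fun n => by
    have : (0 : ℝ) < 1 / ((n : ℝ) + 1) := by positivity
    linarith
  choose c hc1 hc2 u p hcl hdss hI hnt using fun n : ℕ => H (1 + 1 / ((n : ℝ) + 1)) (hpos n)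
  obtain ⟨v, hvc, hvI, hweak, hss, x, hx⟩ := ChaeWolf.exists_limit hC₀ hc1 hc2 hcl hdss hI hnt
  exact hx (congr_fun (ChaeWolf.limit_eq_zero hvc hvI hweak hss) x)

end Literature.Analysis.FluidPDE

end
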